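import Mathlib
import HarnessLib
import Literature.MathematicalPhysics.QuantumLattice.KohnLuttingerLindhardMeasurable
import Summits.HubbardSuperconductivity.HubbardSuperconductivity.Theorems.WeakCouplingBCSWcbcsKohnLuttingerB1gMuWindow

/-!
# Route `ChiralWindow`, crux `CwThesis` (stmt-HubbardSuperconductivity-10438), line `SketchIdeator3` v5:
# the `t' = 0` band is exactly half filled at `μ = 0`, and every hole doping has its chemical potential in the band

For `ε = squareDispersion 1 0`:

* `volume_brillouinZone_le_two_mul_volume_neg` — the particle–hole bound in the OTHER direction:
  `vol BZ ≤ 2 vol({ε < 0} ∩ BZ)` (the four quadrant translations by `(±π, ±π)` map `{ε > 0} ∩ BZ` injectively into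
  `{ε < 0} ∩ BZ`, and the level set `{ε = 0}` is null, `volume_levelSet_squareDispersion`); with
  `two_mul_volume_neg_le` (`…WcbcsKohnLuttingerB1gMuWindow`) this is an equality;
* `filling_zero_eq_one` — **`n(0) = 1`**: the band is half filled at `μ = 0`;
* `chemicalPotentialOfDensity_mem_Ioo_of_mem_Ioo` — for EVERY density `n ∈ (0, 1)` (every hole doping `δ ∈ (0,1)`)
  the chemical potential `μ(n) = chemicalPotentialOfDensity ε n` lies in the open band interval `(-4, 0)` and
  `filling ε (μ n) = n` (`chemicalPotentialOfDensity_spec`, whose hypothesis `n < filling ε 0` is now `n < 1`).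

So the polar picture of the Fermi curve, and with it `channelInf ε (μ(1-δ)) U χ ≤ 0`
(`Theorems.CwThesis.stub_channelInfNonpos`), is available at every hole doping, not only on `[1/4, 12/25]`
(`chemicalPotentialOfDensity_window_mem_Ioo`). No definitions. [folklore]
-/

noncomputable section

-- the tree's namespace repeats the summit name by design (D-0017)
set_option linter.dupNamespace false

namespace Summit.HubbardSuperconductivity.HubbardSuperconductivity.Theorems.CwThesis

open MeasureTheory Real Set
open Literature.MathematicalPhysics.QuantumLattice

/-- **Particle–hole bound, reverse direction**: the volume of the Brillouin zone is at most twice the volume of the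
Fermi sea at `μ = 0`. The four translations by `(±π, ±π)` (sign chosen by the quadrant) map `{ε > 0} ∩ BZ` injectively
into `{ε < 0} ∩ BZ` (`ε(p + (±π,±π)) = -ε(p)`), so `vol{ε > 0} ≤ vol{ε < 0}`; and `BZ ⊆ {ε<0} ∪ {ε>0} ∪ {ε=0}` with
`vol{ε = 0} = 0` (`volume_levelSet_squareDispersion`). [folklore] -/
theorem volume_brillouinZone_le_two_mul_volume_neg :
    volume brillouinZone ≤ 2 * volume (brillouinZone ∩ {p : Momentum | squareDispersion 1 0 p < 0}) := by
  have hε : Measurable (squareDispersion 1 0) := measurable_squareDispersion 1 0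
  have hform : ∀ p : Momentum, squareDispersion 1 0 p = -2 * (cos (p 0) + cos (p 1)) :=
    squareDispersion_one_zero_apply
  set N := brillouinZone ∩ {p : Momentum | squareDispersion 1 0 p < 0} with hN
  set P := brillouinZone ∩ {p : Momentum | 0 < squareDispersion 1 0 p} with hP
  have hNm : MeasurableSet N := measurableSet_brillouinZone.inter (measurableSet_lt hε measurable_const)
  have hPm : MeasurableSet P := measurableSet_brillouinZone.inter (measurableSet_lt measurable_const hε)
  -- translation vectors and pieces of `P`, indexed by the quadrant (is p 0 < 0 ?, is p 1 < 0 ?)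
  let sh : Bool → ℝ := fun b => if b then π else -π
  let v : Bool × Bool → Momentum := fun s => WithLp.toLp 2 ![sh s.1, sh s.2]
  let piece : Bool × Bool → Set Momentum := fun s =>
    P ∩ ({p : Momentum | (p 0 < 0 ↔ s.1 = true)} ∩ {p : Momentum | (p 1 < 0 ↔ s.2 = true)})
  let T : Bool × Bool → Set Momentum := fun s => (· + v s) '' piece s
  have hcoordm : ∀ i : Fin 2, Measurable fun p : Momentum => p i := fun i => by fun_prop
  have hpiece_m : ∀ s, MeasurableSet (piece s) := by
    intro s
    have hc : ∀ (i : Fin 2) (b : Bool), MeasurableSet {p : Momentum | (p i < 0 ↔ b = true)} := by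
      intro i b
      cases b
      · have : {p : Momentum | (p i < 0 ↔ false = true)} = {p : Momentum | p i < 0}ᶜ := by
          ext p; simp
        rw [this]
        exact (measurableSet_lt (hcoordm i) measurable_const).compl
      · have : {p : Momentum | (p i < 0 ↔ true = true)} = {p : Momentum | p i < 0} := by
          ext p; simp
        rw [this]
        exact measurableSet_lt (hcoordm i) measurable_const
    exact hPm.inter ((hc 0 s.1).inter (hc 1 s.2))
  have hT_m : ∀ s, MeasurableSet (T s) := by
    intro s
    change MeasurableSet ((· + v s) '' piece s)
    rw [Set.image_add_right]
    exact (hpiece_m s).preimage (measurable_add_const _)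
  -- `P` is covered by the pieces
  have hPcover : P ⊆ ⋃ s ∈ (Finset.univ : Finset (Bool × Bool)), piece s := by
    intro p hp
    simp only [Finset.mem_univ, Set.iUnion_true, Set.mem_iUnion]
    refine ⟨(decide (p 0 < 0), decide (p 1 < 0)), hp, ?_, ?_⟩ <;> simp
  -- the shifted coordinate: stays in `[-π, π)`, flips the quadrant, flips the cosine
  have hshift : ∀ (x : ℝ) (b : Bool), x ∈ Set.Ico (-π) π → (x < 0 ↔ b = true) →
      x + sh b ∈ Set.Ico (-π) π ∧ (0 ≤ x + sh b ↔ b = true) ∧ cos (x + sh b) = -cos x := by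
    intro x b hx hb
    cases b
    · simp only [Bool.false_eq_true, iff_false, not_lt] at hb
      refine ⟨⟨?_, ?_⟩, ?_, ?_⟩
      · show -π ≤ x + -π; linarith
      · show x + -π < π; linarith [hx.2]
      · simp only [Bool.false_eq_true, iff_false, not_le]; show x + -π < 0; linarith [hx.2]
      · show cos (x + -π) = -cos x; rw [← sub_eq_add_neg, Real.cos_sub_pi]
    · simp only [iff_true] at hb
      refine ⟨⟨?_, ?_⟩, ?_, ?_⟩
      · show -π ≤ x + π; linarith [hx.1]
      · show x + π < π; linarith
      · simp only [iff_true]; show 0 ≤ x + π; linarith [hx.1]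
      · show cos (x + π) = -cos x; exact Real.cos_add_pi x
  -- images land in `N`, in the quadrant determined by `s`
  have hTsub : ∀ s, T s ⊆ N ∩ {q | (0 ≤ q 0 ↔ s.1 = true) ∧ (0 ≤ q 1 ↔ s.2 = true)} := by
    rintro s q ⟨p, ⟨⟨hpBZ, hpP⟩, hp0, hp1⟩, rfl⟩
    have h0 := hshift (p 0) s.1 (hpBZ 0) hp0
    have h1 := hshift (p 1) s.2 (hpBZ 1) hp1
    have hq0 : (p + v s) 0 = p 0 + sh s.1 := by simp [v]
    have hq1 : (p + v s) 1 = p 1 + sh s.2 := by simp [v]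
    refine ⟨⟨?_, ?_⟩, ?_, ?_⟩
    · intro i
      fin_cases i
      · show (p + v s) 0 ∈ _; rw [hq0]; exact h0.1
      · show (p + v s) 1 ∈ _; rw [hq1]; exact h1.1
    · show squareDispersion 1 0 (p + v s) < 0
      rw [hform, hq0, hq1, h0.2.2, h1.2.2]
      have hpP' : 0 < squareDispersion 1 0 p := hpP
      rw [hform] at hpP'
      linarith
    · show (0 ≤ (p + v s) 0 ↔ s.1 = true); rw [hq0]; exact h0.2.1
    · show (0 ≤ (p + v s) 1 ↔ s.2 = true); rw [hq1]; exact h1.2.1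
  have hTdisj : Set.PairwiseDisjoint (↑(Finset.univ : Finset (Bool × Bool))) T := by
    intro s _ s' _ hss'
    rw [Function.onFun, Set.disjoint_left]
    intro q hq hq'
    have h := (hTsub s hq).2
    have h' := (hTsub s' hq').2
    apply hss'
    ext
    · have := h.1.symm.trans h'.1
      cases hs : s.1 <;> cases hs' : s'.1 <;> simp_all
    · have := h.2.symm.trans h'.2
      cases hs : s.2 <;> cases hs' : s'.2 <;> simp_all
  -- vol P ≤ Σ vol (piece s) = Σ vol (T s) = vol (⋃ T s) ≤ vol N
  have h1 : volume P ≤ ∑ s ∈ (Finset.univ : Finset (Bool × Bool)), volume (piece s) :=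
    (measure_mono hPcover).trans (measure_biUnion_finset_le _ _)
  have h2 : ∀ s, volume (piece s) = volume (T s) := by
    intro s
    change volume (piece s) = volume ((· + v s) '' piece s)
    rw [Set.image_add_right, measure_preimage_add_right]
  have h3 : ∑ s ∈ (Finset.univ : Finset (Bool × Bool)), volume (T s) =
      volume (⋃ s ∈ (Finset.univ : Finset (Bool × Bool)), T s) :=
    (measure_biUnion_finset hTdisj fun s _ => hT_m s).symm
  have h4 : (⋃ s ∈ (Finset.univ : Finset (Bool × Bool)), T s) ⊆ N := by
    intro q hq
    simp only [Finset.mem_univ, Set.iUnion_true, Set.mem_iUnion] at hq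
    obtain ⟨s, hs⟩ := hq
    exact (hTsub s hs).1
  have hPN : volume P ≤ volume N := by
    calc volume P ≤ ∑ s ∈ (Finset.univ : Finset (Bool × Bool)), volume (piece s) := h1
      _ = ∑ s ∈ (Finset.univ : Finset (Bool × Bool)), volume (T s) := Finset.sum_congr rfl fun s _ => h2 s
      _ = volume (⋃ s ∈ (Finset.univ : Finset (Bool × Bool)), T s) := h3
      _ ≤ volume N := measure_mono h4
  -- `BZ ⊆ N ∪ P ∪ {ε = 0}` and the level set is null
  have hcover : brillouinZone ⊆ (N ∪ P) ∪ {p : Momentum | squareDispersion 1 0 p = 0} := by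
    intro p hp
    rcases lt_trichotomy (squareDispersion 1 0 p) 0 with h | h | h
    · exact Or.inl (Or.inl ⟨hp, h⟩)
    · exact Or.inr h
    · exact Or.inl (Or.inr ⟨hp, h⟩)
  have hnull : volume {p : Momentum | squareDispersion 1 0 p = 0} = 0 := volume_levelSet_squareDispersion 0
  calc volume brillouinZone ≤ volume ((N ∪ P) ∪ {p : Momentum | squareDispersion 1 0 p = 0}) :=
        measure_mono hcover
    _ ≤ volume (N ∪ P) + volume {p : Momentum | squareDispersion 1 0 p = 0} := measure_union_le _ _
    _ = volume (N ∪ P) := by rw [hnull, add_zero]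
    _ ≤ volume N + volume P := measure_union_le _ _
    _ ≤ volume N + volume N := add_le_add le_rfl hPN
    _ = 2 * volume N := (two_mul _).symm

/-- **The square-lattice band is half filled at `μ = 0`**: `filling ε 0 = 1` for `ε = squareDispersion 1 0`.
[folklore] -/
theorem filling_zero_eq_one : Literature.MathematicalPhysics.QuantumLattice.KohnLuttinger.filling (Literature.MathematicalPhysics.QuantumLattice.squareDispersion 1 0) 0 = 1 := by
  refine le_antisymm (filling_le_one_of_nonpos le_rfl) ?_
  rw [filling_eq]
  have h2 := volume_brillouinZone_le_two_mul_volume_neg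
  rw [volume_brillouinZone, ← ENNReal.ofReal_pow (by positivity)] at h2
  have hfin : volume (brillouinZone ∩ {p : Momentum | squareDispersion 1 0 p < 0}) ≠ ⊤ :=
    (volume_fermiSea_lt_top 0).ne
  have h3 : (2 * π) ^ 2 ≤ 2 * (volume (brillouinZone ∩ {p : Momentum | squareDispersion 1 0 p < 0})).toReal := by
    have := ENNReal.toReal_mono (ENNReal.mul_ne_top ENNReal.ofNat_ne_top hfin) h2
    rw [ENNReal.toReal_ofReal (by positivity), ENNReal.toReal_mul] at this
    simpa using this
  have hπ : 0 < (2 * π) ^ 2 := by positivity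
  rw [le_div_iff₀ hπ, one_mul]
  exact h3

/-- **Every density of `(0, 1)` has its chemical potential in the band**: for `ε = squareDispersion 1 0` and
`0 < n < 1`, `chemicalPotentialOfDensity ε n ∈ (-4, 0)` and `filling ε (chemicalPotentialOfDensity ε n) = n`
(`chemicalPotentialOfDensity_spec` with `filling ε 0 = 1`). In terms of hole doping: every `δ ∈ (0, 1)`, density
`1 - δ`. [folklore] -/
theorem chemicalPotentialOfDensity_mem_Ioo_of_mem_Ioo {n : ℝ} (hn : n ∈ Set.Ioo (0 : ℝ) 1) :
    chemicalPotentialOfDensity (squareDispersion 1 0) n ∈ Set.Ioo (-4 : ℝ) 0 ∧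
      KohnLuttinger.filling (squareDispersion 1 0) (chemicalPotentialOfDensity (squareDispersion 1 0) n) = n :=
  chemicalPotentialOfDensity_spec hn.1 (by rw [filling_zero_eq_one]; exact hn.2)

/-- The hole-doping form: for `δ ∈ (0, 1)` the chemical potential of density `1 - δ` lies in `(-4, 0)`. [folklore] -/
theorem chemicalPotentialOfDensity_doping_mem_Ioo {δ : ℝ} (hδ : δ ∈ Set.Ioo (0 : ℝ) 1) :
    chemicalPotentialOfDensity (squareDispersion 1 0) (1 - δ) ∈ Set.Ioo (-4 : ℝ) 0 :=
  (chemicalPotentialOfDensity_mem_Ioo_of_mem_Ioo ⟨by linarith [hδ.2], by linarith [hδ.1]⟩).1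

end Summit.HubbardSuperconductivity.HubbardSuperconductivity.Theorems.CwThesis

end
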